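import Mathlib
import Summits.Ventures.HodgeRepro2.T7SupportDominantGeometricSide
import Summits.Ventures.HodgeRepro2.Tier7.Line3.AbsSummable

/-!
# Tier 7 — LINE 3 support: a NON-TRIVIAL instance of p1's `DominantSide` (joint satisfiability of the analytic fields)
(`Line3/DominantSideInstance.lean`; t7-L1-p1, gen 2; Mathlib + p1's DominantSide + p5's AbsSummable)

crit-2 g2 (l. 15154 (4), l. 15105 (i)): the one-point witness `DominantSide.trivial` (RealDominant.lean) inhabits the
version-(ii) shape on `datumA` by a COSTUME — `Orb = Unit`, constants `1 / 0`, `size_of_arith` vacuous — so it certifies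
non-vacuity of `RealDominant` as a Prop, «not joint satisfiability of the analytic fields (size / count / decay / identity)
with a non-trivial `Orb`». This file supplies exactly that witness: a `DominantSide` over the INFINITE double-coset set
`Orb = ℤ` whose analytic fields are all genuine —
* `size n = |n|`, the dominant coset `γ₀ = 0`, the level-`N` support `arith N n ↔ (n = 0 ∨ N ≤ |n|)` (the cosets `≠ γ₀`
  carrying weight at level `N` have size `≥ ρ N = N`, a threshold going to infinity — `size_of_arith`, `hρ`),
* the archimedean factor `a n = (1 + |n|)^(-2)` (decay exponent `α = 2`), the finite factor `b N n = 1` on the support and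
  `0` off it (growth `d' = 0`, `b_bound` with `B = 1` relative to `b N 0 = 1`),
* the count `#{n : arith N n ∧ |n| ≤ R} ≤ 3 (1 + R)` (`β = 1`; uniform in `N`), the exponent condition `β + d' = 1 < 2 = α`,
* `abs_summable` from p5's `summable_of_count_decay` (the count × decay argument, not a finite sum: the level-`N`
  support `{n : b N n ≠ 0} = {0} ∪ {|n| ≥ N}` is INFINITE — `support_infinite`),
* `identity` with a one-label spectral side `Rep = Unit`, `spec N () := Σ'_n orb N n` (the spectral side is the costume
  here: one label carrying the whole geometric total), `a_γ₀ = 1 ≠ 0`, `b_γ₀ = 1 ≠ 0`.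
So `DominantSide.exists_geom_ne_zero` fires on a genuinely infinite geometric side (`exists_geom_ne_zero_instZ`): the
dominant-term package (decay / count / growth / threshold / dominant term / absolute convergence) is jointly satisfiable
with a non-trivial `Orb`. It says nothing about any group, torus, test function or period, and nothing about (N).

Sorry-free; axioms: propext / Classical.choice / Quot.sound. §8(d): uses an L-value-free non-vanishing device: NO.
-/

namespace Summit.Ventures.HodgeRepro2.Tier7.Line3.DominantSideInstance

open Summit.Ventures.HodgeRepro2.T7SupportDominantGeometricSide Filter Topology

/-- the archimedean factor: polynomial decay `(1 + |n|)^(-2)` in the size `|n|`. -/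
noncomputable def aZ (n : ℤ) : ℂ := (((1 + |(n : ℝ)|) ^ (-(2 : ℝ)) : ℝ) : ℂ)

/-- the level-`N` support: the dominant coset `0` and the cosets of size `≥ N`. -/
def arithZ (N : ℕ) (n : ℤ) : Prop := n = 0 ∨ (N : ℝ) ≤ |(n : ℝ)|

/-- the finite factor at level `N`: `1` on the support, `0` off it. -/
noncomputable def bZ (N : ℕ) (n : ℤ) : ℂ := if n = 0 ∨ (N : ℝ) ≤ |(n : ℝ)| then 1 else 0

/-- the orbital weight `orb N n = aZ n * bZ N n`. -/
noncomputable def orbZ (N : ℕ) (n : ℤ) : ℂ := aZ n * bZ N n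

/-- `‖aZ n‖ = (1 + |n|)^(-2)`. -/
theorem norm_aZ (n : ℤ) : ‖aZ n‖ = (1 + |(n : ℝ)|) ^ (-(2 : ℝ)) := by
  unfold aZ
  rw [Complex.norm_real, Real.norm_eq_abs, abs_of_nonneg (Real.rpow_nonneg (by positivity) _)]

/-- `bZ N n = 1` on the level-`N` support. -/
theorem bZ_of_arith {N : ℕ} {n : ℤ} (h : arithZ N n) : bZ N n = 1 := by
  have h' : n = 0 ∨ (N : ℝ) ≤ |(n : ℝ)| := h
  unfold bZ; exact if_pos h'

/-- `bZ N n = 0` off the level-`N` support. -/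
theorem bZ_of_not_arith {N : ℕ} {n : ℤ} (h : ¬ arithZ N n) : bZ N n = 0 := by
  have h' : ¬ (n = 0 ∨ (N : ℝ) ≤ |(n : ℝ)|) := h
  unfold bZ; exact if_neg h'

/-- `‖bZ N n‖ ≤ 1`. -/
theorem norm_bZ_le (N : ℕ) (n : ℤ) : ‖bZ N n‖ ≤ 1 := by
  unfold bZ
  split_ifs <;> simp

/-- the dominant coset `0` carries weight `1` at every level. -/
theorem bZ_zero (N : ℕ) : bZ N 0 = 1 := bZ_of_arith (Or.inl rfl)

/-- `aZ 0 = 1`. -/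
theorem aZ_zero : aZ 0 = 1 := by
  unfold aZ; simp

/-- the count of integers of size `≤ R`: at most `3 (1 + R)`, uniformly in the level. -/
theorem count_le (R : ℝ) (hR : 0 ≤ R) :
    ∃ s : Finset ℤ, (∀ n : ℤ, |(n : ℝ)| ≤ R → n ∈ s) ∧ (s.card : ℝ) ≤ 3 * (1 + R) ^ (1 : ℝ) := by
  refine ⟨Finset.Icc (-(⌊R⌋₊ : ℤ)) (⌊R⌋₊ : ℤ), fun n hn => ?_, ?_⟩
  · have h4 : n.natAbs ≤ ⌊R⌋₊ := Nat.le_floor (by rw [Nat.cast_natAbs, Int.cast_abs]; exact hn)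
    have h1 : (|n| : ℤ) ≤ ⌊R⌋₊ := by
      rw [← Int.natCast_natAbs]; exact_mod_cast h4
    rw [Finset.mem_Icc]
    constructor
    · linarith [neg_abs_le n]
    · linarith [le_abs_self n]
  · rw [Int.card_Icc, Real.rpow_one]
    have h1 : ((⌊R⌋₊ : ℕ) : ℝ) ≤ R := Nat.floor_le hR
    have h2 : ((⌊R⌋₊ : ℤ) + 1 - -(⌊R⌋₊ : ℤ)).toNat = 2 * ⌊R⌋₊ + 1 := by omega
    rw [h2]; push_cast; linarith

/-- **the instance**: a dominant-side shadow over `Orb = ℤ` with one spectral label. -/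
noncomputable def instZ : DominantSide Unit ℤ (fun _ => True) (fun _ => True) where
  spec := fun N _ => ∑' n : ℤ, orbZ N n
  spec_zero_A := fun _ _ h => absurd trivial h
  spec_zero_B := fun _ _ h => absurd trivial h
  a := aZ
  b := bZ
  orb := orbZ
  orb_eq := fun _ _ => rfl
  abs_summable := fun N => by
    have h := AbsSummable.summable_of_count_decay aZ (bZ N) (fun n => |(n : ℝ)|) (fun n => abs_nonneg _)
      (arithZ N) (fun n hn => by by_contra h; exact hn (bZ_of_not_arith h)) (α := 2) (β := 1) (d' := 0)
      zero_le_one (by norm_num) (C := 1) (fun n => by rw [norm_aZ, one_mul])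
      (C' := 3) (fun R hR => by
        obtain ⟨s, hs, hcard⟩ := count_le R hR
        exact ⟨s, fun n _ hn => hs n hn, hcard⟩)
      (Bb := 1) (fun n hn => by rw [bZ_of_arith hn, Real.rpow_zero]; simp)
    exact h
  identity := fun N => by simp [tsum_fintype]
  γ₀ := 0
  size := fun n => |(n : ℝ)|
  size_nonneg := fun n => abs_nonneg _
  arith := arithZ
  b_support := fun N n hn => by by_contra h; exact hn (bZ_of_not_arith h)
  α := 2
  β := 1
  d' := 0
  hβ := zero_le_one
  hd' := le_rfl
  hαβ := by norm_num
  a_bound := ⟨1, fun n => by rw [norm_aZ, one_mul]⟩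
  ρ := fun N => (N : ℝ)
  hρ := tendsto_natCast_atTop_atTop
  size_of_arith := fun N n hn hne => by
    rcases hn with h | h
    · exact absurd h hne
    · exact h
  count_bound := ⟨3, fun N R hR => by
    obtain ⟨s, hs, hcard⟩ := count_le R hR
    exact ⟨s, fun n _ hn => hs n hn, hcard⟩⟩
  b_bound := ⟨1, fun N n hn => by
    rw [bZ_of_arith hn, bZ_zero, Real.rpow_zero]; simp⟩
  a_γ₀ := by rw [aZ_zero]; exact one_ne_zero
  b_γ₀ := ⟨0, fun N _ => by rw [bZ_zero]; exact one_ne_zero⟩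

/-- the level-`N` geometric support is INFINITE (every `n` with `|n| ≥ N` carries weight): the geometric side of the
instance is a genuinely infinite absolutely convergent sum, not a finite one in disguise. -/
theorem support_infinite (N : ℕ) : Set.Infinite {n : ℤ | bZ N n ≠ 0} := by
  apply Set.infinite_of_not_bddAbove
  intro ⟨M, hM⟩
  have hmem : (max M N : ℤ) + 1 ∈ {n : ℤ | bZ N n ≠ 0} := by
    show bZ N (max M N + 1) ≠ 0
    rw [bZ_of_arith (Or.inr ?_)]
    · exact one_ne_zero
    · have h1 : (N : ℤ) ≤ max M N + 1 := by omega
      have h2 : ((N : ℤ) : ℝ) ≤ ((max M N + 1 : ℤ) : ℝ) := by exact_mod_cast h1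
      calc (N : ℝ) = ((N : ℤ) : ℝ) := by norm_cast
        _ ≤ ((max M N + 1 : ℤ) : ℝ) := h2
        _ ≤ |((max M N + 1 : ℤ) : ℝ)| := le_abs_self _
  have := hM hmem
  omega

/-- the dominant-term argument fires on the instance: some level has a non-zero (infinite) geometric side. -/
theorem exists_geom_ne_zero_instZ : ∃ N, ∑' n : ℤ, orbZ N n ≠ 0 :=
  instZ.exists_geom_ne_zero

end Summit.Ventures.HodgeRepro2.Tier7.Line3.DominantSideInstance
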